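import Literature.Geometry.Lorentzian.AdiabaticTracking
import Literature.Geometry.Lorentzian.AdiabaticTrackingWindows
import Literature.Geometry.Lorentzian.ApproximateKerrConfigurationReanchor
import Summits.FinalStateConjecture.FinalStateConjecture.Statement
import Summits.FinalStateConjecture.FinalStateConjecture.Theorems.RenormalisedDriftDriftCaptureFreezeFragments
import HarnessLib

/-!
# FREEZE core of crux `DriftCapture` (stmt-FinalStateConjecture-17391), line `birth` v6:
# what ONE sharpening chain gives back formally (no restart)

The registered stub `stub_sharpTrackingChain` of the skeleton
`Summits/FinalStateConjecture/FinalStateConjecture/Cruxes/DriftCapture/Lines/birth.lean` (v6) is the route's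
ENGINE: on the live range `0 < N`, `0 < m₀ ≤ 1`, `0 ≤ χ < 1`, an MGHD with complete `𝓘⁺` tracked at EVERY
accuracy (`VacuumCauchyDevelopment.IsAdiabaticallyTracked`, window charts with mutually unrelated labels) carries
ONE chain `n ↦ cₙ` of `εₙ`-approximate `N`-Kerr configurations on chart-time windows `[0, 1]` with `εₙ → 0`,
near-zone radii `Rₙ → ∞`, labels in the moduli box, chained start slabs, exhaustion, pinned and covered region
`O`, and CAUCHY labels. It is research-level (renormalised, parameter-re-anchored bootstrap on slow steps with a
first-law budget; Klainerman, C. R. Mécanique 353 (2025), §2.3: asymptotic ORBITAL stability along the Kerr moduli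
space) and is not proved here: no tree operation produces a configuration at a NEW (smaller) accuracy or with NEW
labels (`ApproximateKerrConfiguration.mono` / `.ofLE` / `.reanchor` keep masses, spins and Lorentz parts by `rfl`;
`mono` relaxes `ε` upwards, `ofLE` lowers `k`, `reanchor` shifts the start time; the only other constructor,
`FinalStateDecomposition.eventually_nonempty_approximateKerrConfiguration`, consumes the decomposition the crux is
to produce), and the chains the hypothesis supplies at different accuracies live in a priori different
self-determined regions `O`, whereas the conclusion's chain is typed over ONE `O` and tied to it by pinning,
covering and chaining — so no diagonal / spliced chain type-checks, and along any one supplied chain the accuracy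
is constant `ε > 0`, never `→ 0`.

Remarks on the engine statement (paper, not formal). (1) The Lorentz label `Λᵢ` of a window is gauge: the hole
chart `Ψᵢ` read over `(B Λᵢ, B cᵢ)` after precomposition with `B⁻¹` (`B ∈ O(1,3)`) certifies the same sets at an
accuracy worse by a factor depending on `‖B‖` only, and the near-Poincaré transition to the flat chart is not
recorded; along a sharpening chain bounded relabellings keep `εₙ → 0`, so the Cauchy clause carries physical
content through the masses and `|aᵢ|` (the sign of `aᵢ` is absorbed by a rotation), i.e. the first-law budget.
(2) Certified hole slabs are rest-frame simultaneity discs of radius `Rₙ → ∞`, the flat window has chart-time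
width `L`; chaining an ENTIRE start slab into the previous window image therefore forces, at every step where the
radius grows, the flat chart's local frame near each hole to be comoving up to `O(L / Rₙ)` (and consecutive hole
frames to agree up to `O(L / Rₙ)`), which for several holes with distinct velocities is met only by slowly bending
flat charts (`C²`-`ε`-flatness on unit slabs allows frame drift `O(ε)` per unit length), bounding the attainable
accuracy of window `n` from below by `(rapidity spread) / (hole separation)`. Neither remark yields a formal
reduction; both concern which models satisfy hypothesis and conclusion (on paper, exact Kerr exteriors and settling
multi-Kerr spacetimes with receding holes do, with constant labels).

This file lands the bookkeeping in the CONVERSE direction — exactly what a sharpening chain hands back to the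
seam without any restart geometry:

* `isAdiabaticallyTracked_of_sharpChain_of_le` — a chain of `εₙ`-approximate configurations on windows `[0, L]`
  over one region `O` with the radii / complexity / chaining / exhaustion / pinning / covering clauses of the seam
  and UNIFORM bounds `εₙ ≤ ε₀`, `R₀ ≤ Rₙ` is an adiabatic tracking of `𝒟` at accuracy `(ε₀, L, R₀)` (window-wise
  `ApproximateKerrConfiguration.mono`). So a sharpening chain is, as it stands, only a tracking chain at its
  WORST accuracy `supₙ εₙ`.
* `sharpChain_tail` — for every target accuracy `ε₀ > 0` and radius floor `R₀` some TAIL `n ↦ c_{n₀+n}` of a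
  sharpening chain (`εₙ → 0`, `Rₙ → ∞`), relaxed to `ε₀`, satisfies the four LOCAL clauses of the seam at
  `(ε₀, L, R₀)` — radii, complexity, chaining, exhaustion — with the same certified window images, certified slabs
  and labels. The two GLOBAL clauses are NOT inherited: pinning `O = J⁺(ι X) ∩ I⁻(⋃_{n ≥ n₀} windows)` and
  covering `O ⊆ J⁻(slab₀(c_{n₀})) ∪ ⋃_{n ≥ n₀} windows` for the tail are causal-geometric identities about window
  images (early windows lie in the causal past of later start slabs; push-up), i.e. the RESTART content.
* `isAdiabaticallyTracked_of_sharpChain_of_restart` — consequently, a sharpening chain whose every tail is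
  again pinned and covered (the two restart identities, taken as hypotheses) is an adiabatic tracking of `𝒟` at
  EVERY accuracy `ε₀ > 0` and every radius floor, at its window length `L`.

No definitions are introduced and no named facts are used.

References: Klainerman, C. R. Mécanique 353 (2025), §1.1.1 and §2.3; Dafermos–Holzegel–Rodnianski–Taylor
arXiv:2104.08222, §1 (the `Cᵏ`-deviation vocabulary of `ApproximateKerrConfiguration`; "remains close" is an
upper bound, so accuracies relax upwards only).
-/

-- the doubled `FinalStateConjecture.FinalStateConjecture` path component trips dupNamespace
set_option linter.dupNamespace false

noncomputable section

namespace Summit.FinalStateConjecture.FinalStateConjecture.Theorems.RenormalisedDrift.DriftCapture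

open Set Filter Topology
open scoped Manifold ContDiff ENNReal
open Literature.Geometry.Lorentzian

/-- **A sharpening chain with uniform bounds is a tracking chain at its worst accuracy.** For any vacuum Cauchy
development `𝒟`, complexity `(N, m₀, χ)`, window length `L`, accuracy `ε₀` and radius floor `R₀`: a chain
`n ↦ cₙ` of `εₙ`-approximate `N`-Kerr configurations of ONE region `O` in `C²` on the chart-time windows `[0, L]`
with near-zone radii `Rₙ`, satisfying `εₙ ≤ ε₀` and `R₀ ≤ Rₙ` for ALL `n`, `Rₙ → ∞`, exactly `N` holes with labels
in the box `[m₀, m₀⁻¹] × {|a| ≤ χ M}`, chained start slabs, exhaustion of every compact past,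
`O = J⁺(ι X) ∩ I⁻(⋃ₙ windows)` and `O ⊆ J⁻(slab₀(c₀)) ∪ ⋃ₙ windows`, witnesses
`𝒟.IsAdiabaticallyTracked N m₀ χ ε₀ L R₀`: relax every window to accuracy `ε₀`
(`ApproximateKerrConfiguration.mono`, which keeps holes, labels, certified slabs and window images by `rfl`).
DHRT arXiv:2104.08222, §1 ("remains close" is an upper bound). [cite: arXiv210408222, §1] -/
theorem isAdiabaticallyTracked_of_sharpChain_of_le : ∀ {X : Type} [TopologicalSpace X] [ChartedSpace E3 X] [IsManifold (𝓡 3) ((⊤ : ℕ∞) : WithTop ℕ∞) X] [ConnectedSpace X] {D : InitialDataSet (𝓡 3) X} (𝒟 : VacuumCauchyDevelopment D) (N : ℕ) (m₀ χ L : ℝ) (ε₀ : ENNReal) (R₀ : ℝ) (ε : ℕ → ENNReal) (R : ℕ → ℝ) (O : Set 𝒟.carrier) (c : ∀ n : ℕ, ApproximateKerrConfiguration 𝒟.toSpacetime O 2 (ε n) 0 L (R n)), (∀ n, ε n ≤ ε₀) → (∀ n, R₀ ≤ R n) → Tendsto R atTop atTop → (∀ n, (c n).N = N) → (∀ n (i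 : Fin (c n).N), m₀ ≤ (c n).mass i ∧ (c n).mass i ≤ m₀⁻¹ ∧ |(c n).spin i| ≤ χ * (c n).mass i) → (∀ n, (c (n + 1)).certifiedSlab 0 ⊆ (c n).windowImage) → (∀ K : Set 𝒟.carrier, IsCompact K → ∃ n₀ : ℕ, ∀ n, n₀ ≤ n → Disjoint (c n).windowImage (𝒟.metric.causalPast 𝒟.timeOrientation K)) → O = 𝒟.toCauchyDevelopment.exteriorOf (⋃ n, (c n).windowImage) → O ⊆ 𝒟.metric.causalPast 𝒟.timeOrientation ((c 0).certifiedSlab 0) ∪ ⋃ n, (c n).windowImage → 𝒟.IsAdiabaticallyTracked N m₀ χ ε₀ L R₀ := by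
  intro X _ _ _ _ D 𝒟 N m₀ χ L ε₀ R₀ ε R O c hε hR hRt hN hM hch hex hO hcov
  exact ⟨R, O, fun n ↦ (c n).mono (hε n), hR, hRt, hN, hM, hch, hex, hO, hcov⟩

/-- **Tails of a sharpening chain: the four local clauses at every accuracy.** For any vacuum Cauchy development
`𝒟`, complexity `(N, m₀, χ)` and window length `L`: let `n ↦ cₙ` be a chain of `εₙ`-approximate `N`-Kerr
configurations of one region `O` in `C²` on the windows `[0, L]` with radii `Rₙ`, where `εₙ → 0`, `Rₙ → ∞`, every
`cₙ` has exactly `N` holes with labels in the box, the start slabs are chained and the window images leave every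
compact past. Then for every accuracy `ε₀ > 0` and radius floor `R₀` there are `n₀` and a chain
`n ↦ c'ₙ` of `ε₀`-approximate configurations of `O` on `[0, L]` with radii `R_{n₀+n} ≥ R₀`, `R_{n₀+n} → ∞`, `N`
holes in the box, chained, exhausting, and with the SAME window images, certified slabs and labels (masses, spins,
motions, index by index) as the tail `n ↦ c_{n₀+n}`: take `n₀` with `εₙ ≤ ε₀` and `R₀ ≤ Rₙ` beyond it and relax
(`ApproximateKerrConfiguration.mono`). What such a tail does NOT inherit are the two global clauses of
`VacuumCauchyDevelopment.IsAdiabaticallyTracked` — pinning `O = J⁺(ι X) ∩ I⁻(⋃_{n ≥ n₀} windows)` and covering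
`O ⊆ J⁻(slab₀(c_{n₀})) ∪ ⋃_{n ≥ n₀} windows` — which are identities of causal geometry (restart).
Klainerman, C. R. Mécanique 353 (2025), §2.3; DHRT arXiv:2104.08222, §1. [folklore] -/
theorem sharpChain_tail : ∀ {X : Type} [TopologicalSpace X] [ChartedSpace E3 X] [IsManifold (𝓡 3) ((⊤ : ℕ∞) : WithTop ℕ∞) X] [ConnectedSpace X] {D : InitialDataSet (𝓡 3) X} (𝒟 : VacuumCauchyDevelopment D) (N : ℕ) (m₀ χ L : ℝ) (ε : ℕ → ENNReal) (R : ℕ → ℝ) (O : Set 𝒟.carrier) (c : ∀ n : ℕ, ApproximateKerrConfiguration 𝒟.toSpacetime O 2 (ε n) 0 L (R n)), Tendsto ε atTop (𝓝 0) → Tendsto R atTop atTop → (∀ n, (c n).N = N) → (∀ n (i : Fin (c n).N), m₀ ≤ (c n).mass i ∧ (c n).mass i ≤ m₀⁻¹ ∧ |(c n).spin i| ≤ χ * (c n).mass i) → (∀ n, (c (n + 1)).certifiedSlab 0 ⊆ (c n).windowImage) → (∀ K : Set 𝒟.carrier, IsCompact K → ∃ n₀ : ℕ, ∀ n, n₀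 ≤ n → Disjoint (c n).windowImage (𝒟.metric.causalPast 𝒟.timeOrientation K)) → ∀ (ε₀ : ENNReal) (R₀ : ℝ), 0 < ε₀ → ∃ (n₀ : ℕ) (c' : ∀ n : ℕ, ApproximateKerrConfiguration 𝒟.toSpacetime O 2 ε₀ 0 L (R (n₀ + n))), (∀ n, R₀ ≤ R (n₀ + n)) ∧ Tendsto (fun n ↦ R (n₀ + n)) atTop atTop ∧ (∀ n, (c' n).N = N) ∧ (∀ n (i : Fin (c' n).N), m₀ ≤ (c' n).mass i ∧ (c' n).mass i ≤ m₀⁻¹ ∧ |(c' n).spin i| ≤ χ * (c' n).mass i) ∧ (∀ n, (c' (n + 1)).certifiedSlab 0 ⊆ (c' n).windowImage) ∧ (∀ K : Set 𝒟.carrier, IsCompact K → ∃ n₁ : ℕ, ∀ n, n₁ ≤ n → Disjoint (c' n).windowImage (𝒟.metric.causalPast 𝒟.timeOrientation K)) ∧ (∀ n, (c' n).windowImage = (c (n₀ + n)).windowImage) ∧ (∀ n (σ : ℝ), (c' n).certifiedSlab σ = (c (n₀ + n)).certifiedSlab σ) ∧ (∀ n (i : Fin (c' n).N), ∃ j : Fin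 (c (n₀ + n)).N, (i : ℕ) = (j : ℕ) ∧ (c' n).mass i = (c (n₀ + n)).mass j ∧ (c' n).spin i = (c (n₀ + n)).spin j ∧ (c' n).motion i = (c (n₀ + n)).motion j) := by
  intro X _ _ _ _ D 𝒟 N m₀ χ L ε R O c hε hRt hN hM hch hex ε₀ R₀ hε₀
  -- beyond some `n₀` the accuracies are `≤ ε₀` and the radii `≥ R₀`
  have h1 : ∀ᶠ n in atTop, ε n ≤ ε₀ := hε.eventually (ge_mem_nhds hε₀)
  have h2 : ∀ᶠ n in atTop, R₀ ≤ R n := hRt.eventually (eventually_ge_atTop R₀)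
  obtain ⟨n₀, hn₀⟩ := eventually_atTop.1 (h1.and h2)
  have hshift : Tendsto (fun n : ℕ ↦ n₀ + n) atTop atTop :=
    tendsto_atTop_atTop.2 fun b ↦ ⟨b, fun n hn ↦ hn.trans (Nat.le_add_left n n₀)⟩
  refine ⟨n₀, fun n ↦ (c (n₀ + n)).mono (hn₀ (n₀ + n) (Nat.le_add_right n₀ n)).1,
    fun n ↦ (hn₀ (n₀ + n) (Nat.le_add_right n₀ n)).2, hRt.comp hshift, fun n ↦ hN (n₀ + n),
    fun n ↦ hM (n₀ + n), fun n ↦ hch (n₀ + n), fun K hK ↦ ?_, fun n ↦ rfl, fun n σ ↦ rfl,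
    fun n i ↦ ⟨i, rfl, rfl, rfl, rfl⟩⟩
  obtain ⟨n₁, hn₁⟩ := hex K hK
  exact ⟨n₁, fun n hn ↦ hn₁ (n₀ + n) (hn.trans (Nat.le_add_left n n₀))⟩

/-- **A sharpening chain whose tails are pinned and covered is a tracking at every accuracy.** For any vacuum
Cauchy development `𝒟`, complexity `(N, m₀, χ)` and window length `L`: a chain `n ↦ cₙ` of `εₙ`-approximate
`N`-Kerr configurations of one region `O` in `C²` on the windows `[0, L]` with `εₙ → 0`, `Rₙ → ∞`, `N` holes in
the box, chained start slabs and exhaustion, such that EVERY tail `n ↦ c_{n₀+n}` pins and covers the same region —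
`O = J⁺(ι X) ∩ I⁻(⋃ₙ windowImage(c_{n₀+n}))` and `O ⊆ J⁻(slab₀(c_{n₀})) ∪ ⋃ₙ windowImage(c_{n₀+n})` for all `n₀` (the
two restart identities) — witnesses `𝒟.IsAdiabaticallyTracked N m₀ χ ε₀ L R₀` for EVERY accuracy `ε₀ > 0` and
every radius floor `R₀` (the tail of `sharpChain_tail`, whose global clauses are now supplied). This is the exact
formal converse, at fixed window length, of the engine statement `stub_sharpTrackingChain` modulo restart
geometry. Klainerman, C. R. Mécanique 353 (2025), §2.3; DHRT arXiv:2104.08222, §1. [folklore] -/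
theorem isAdiabaticallyTracked_of_sharpChain_of_restart : ∀ {X : Type} [TopologicalSpace X] [ChartedSpace E3 X] [IsManifold (𝓡 3) ((⊤ : ℕ∞) : WithTop ℕ∞) X] [ConnectedSpace X] {D : InitialDataSet (𝓡 3) X} (𝒟 : VacuumCauchyDevelopment D) (N : ℕ) (m₀ χ L : ℝ) (ε : ℕ → ENNReal) (R : ℕ → ℝ) (O : Set 𝒟.carrier) (c : ∀ n : ℕ, ApproximateKerrConfiguration 𝒟.toSpacetime O 2 (ε n) 0 L (R n)), Tendsto ε atTop (𝓝 0) → Tendsto R atTop atTop → (∀ n, (c n).N = N) → (∀ n (i : Fin (c n).N), m₀ ≤ (c n).mass i ∧ (c n).mass i ≤ m₀⁻¹ ∧ |(c n).spin i| ≤ χ * (c n).mass i) → (∀ n, (c (n + 1)).certifiedSlab 0 ⊆ (c n).windowImage) → (∀ K : Set 𝒟.carrier, IsCompact K → ∃ n₀ : ℕ, ∀ n, n₀ ≤ n → Disjoint (c n).windowImage (𝒟.metric.causalPast 𝒟.timeOrientation K)) → (∀ n₀ : ℕ, O = 𝒟.toCauchyDevelopment.exteriorOf (⋃ n, (c (n₀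 + n)).windowImage)) → (∀ n₀ : ℕ, O ⊆ 𝒟.metric.causalPast 𝒟.timeOrientation ((c n₀).certifiedSlab 0) ∪ ⋃ n, (c (n₀ + n)).windowImage) → ∀ (ε₀ : ENNReal) (R₀ : ℝ), 0 < ε₀ → 𝒟.IsAdiabaticallyTracked N m₀ χ ε₀ L R₀ := by
  intro X _ _ _ _ D 𝒟 N m₀ χ L ε R O c hε hRt hN hM hch hex hpin hcov ε₀ R₀ hε₀
  obtain ⟨n₀, c', hR, hRt', hN', hM', hch', hex', hW, hS, -⟩ :=
    sharpChain_tail 𝒟 N m₀ χ L ε R O c hε hRt hN hM hch hex ε₀ R₀ hε₀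
  refine ⟨fun n ↦ R (n₀ + n), O, c', hR, hRt', hN', hM', hch', hex', ?_, ?_⟩
  · rw [iUnion_congr hW]
    exact hpin n₀
  · rw [hS 0 0, iUnion_congr hW]
    exact hcov n₀

end Summit.FinalStateConjecture.FinalStateConjecture.Theorems.RenormalisedDrift.DriftCapture

end
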